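import Summits.SmoothPoincare4.SmoothPoincare4.Theses.CongruenceShadows
import Summits.SmoothPoincare4.SmoothPoincare4.Theorems.CongruenceShadowsAbelianShadowStandardAdaptedBasis
import Summits.SmoothPoincare4.SmoothPoincare4.Theorems.CongruenceShadowsAbelianShadowStandardCutLagrangian
import Literature.Topology.FourManifolds.SurfaceGroupSymplecticRealisation
import Literature.Topology.FourManifolds.SymplecticBasisTransitivity
import Literature.Topology.FourManifolds.SurfaceGroupAbelianisationKernels
import Literature.Topology.FourManifolds.SurfaceGroupFreeCharactersIsotropic
import Mathlib.LinearAlgebra.Pi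
import HarnessLib

/-!
# `CongruenceShadows.AbelianShadowStandard` (item stmt-SmoothPoincare4-14599): the abelian
# shadow of every group trisection of the trivial group is standard

Route `SmoothPoincare4/CongruenceShadows`, support item `AbelianShadowStandard` = the `c = 0`
rung of the crux `NilpotentShadowsStandard`: for every `(3+3m; m+1)` group trisection `K` of the
trivial group (Abrams–Gay–Kirby, kernel form `IsGroupTrisection`) there is `ψ ∈ Aut S`,
`S = S_{3+3m}` the surface group, with `ψ(Nᵢ·γ₂S) = Kᵢ·γ₂S` for `i = 0,1,2`
(`N = s4Kernels.stabilizeIter m`, `γ₂S = (⊤).lowerCentralSeries 1 = [S,S]`).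

Assembly of:
* `Literature/…/SurfaceGroupAbelianisationKernels` — `ker abelianize = γ₂`, exactness
  `Kᵢ → H₁(S) → H₁(F) → 0` for free quotients (split surjections `R`, `ker R = [Kᵢ]`);
* `Literature/…/SurfaceGroupFreeCharactersIsotropic` — rows of `R` are `ν`-isotropic (cup
  products from a free group vanish; Heisenberg-group proof);
* `Literature/…/SymplecticLagrangianKernel` — hence `[Kᵢ]` is Lagrangian;
* `…AbelianShadowStandardAdaptedBasis` — integral normal form: an isometry `f` of `H₁` with
  `f(Λᵢ) = [Kᵢ]`, `Λᵢ` the coordinate Lagrangians of the standard trisection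
  (`…CutLagrangian`: `[Nᵢ] = span{δ_x : x ∈ s4CutSystem m i}`, the cut normal form);
* `Literature/…/SurfaceGroupSymplecticRealisation` — `f` (a symplectic basis) is induced by an
  automorphism of `S` (Zieschang–Vogt–Coldewey Thm. 3.6.7 (b): `Aut S_g ↠ Sp`, via the
  elementary generators 3.6.9 and their transitivity 3.6.10/3.6.12).

`abelianShadowStandard_proof : AbelianShadowStandard` is unconditional (no named facts).
-/

-- the prescribed namespace `Summit.<P>.<Sub>.…` duplicates `SmoothPoincare4` (P = Sub)
set_option linter.dupNamespace false

noncomputable section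

open Finset Subgroup Literature.Topology.FourManifolds

namespace Summit.SmoothPoincare4.SmoothPoincare4.Theorems.AbelianShadowStandard

section AdaptedEquiv

open Literature.Algebra.Lie

/-- **The adapted symplectic basis as a linear automorphism.**  Under the hypotheses of
`exists_adapted_symplecticBasis`, there are a symplectic basis `(α, β)` and an isometry `f` of
`(ℤ^{2g}, ν)` with `f δ_{aⱼ} = αⱼ`, `f δ_{bⱼ} = βⱼ`, such that each `Lᵢ` is carried by `f` from
the coordinate Lagrangian spanned by the `i`-th cut system: `x ∈ Lᵢ ↔ f⁻¹ x` is supported on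
`s4CutSystem m i`.  (Spanning of `(α, β)` comes from the transitivity theorem
`exists_mem_apply_eq_of_isSymplecticBasis` applied inside the isometry group; the coefficients of
`x ∈ Lᵢ` are `ν(x, βⱼ)`, `-ν(x, αⱼ)`, which vanish off the cut system by isotropy.) [folklore] -/
theorem exists_adapted_linearEquiv (m : ℕ)
    (L : Fin 3 → Submodule ℤ (surfaceGen (3 + 3 * m) → ℤ))
    (hiso : ∀ l, ∀ x ∈ L l, ∀ y ∈ L l, symplForm x y = 0)
    (hmax : ∀ l x, (∀ y ∈ L l, symplForm x y = 0) → x ∈ L l)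
    (Rp : Fin 3 → ((surfaceGen (3 + 3 * m) → ℤ) →ₗ[ℤ] (Fin (m + 1) → ℤ)))
    (Up : Fin 3 → ((Fin (m + 1) → ℤ) →ₗ[ℤ] (surfaceGen (3 + 3 * m) → ℤ)))
    (hRU : ∀ l y, Rp l (Up l y) = y)
    (hker : ∀ l l', l ≠ l' → ∀ x ∈ L l', Rp l x = 0)
    (htop : ∀ x : surfaceGen (3 + 3 * m) → ℤ, ∃ y : Fin 3 → surfaceGen (3 + 3 * m) → ℤ,
      (∀ l, y l ∈ L l) ∧ x = ∑ l, y l) :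
    ∃ (α β : Fin (3 + 3 * m) → surfaceGen (3 + 3 * m) → ℤ)
      (f : (surfaceGen (3 + 3 * m) → ℤ) ≃ₗ[ℤ] (surfaceGen (3 + 3 * m) → ℤ)),
      IsSymplecticBasis α β ∧
      (∀ j, f (Pi.single (j, false) 1) = α j ∧ f (Pi.single (j, true) 1) = β j) ∧
      ∀ (i : Fin 3) (x : surfaceGen (3 + 3 * m) → ℤ),
        x ∈ L i ↔ ∀ y : surfaceGen (3 + 3 * m), y ∉ s4CutSystem m i → f.symm x y = 0 := by
  obtain ⟨α, β, hαβ, hαL, hβL⟩ := exists_adapted_symplecticBasis m L hiso hmax Rp Up hRU hker htop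
  -- the isometry group contains all moves
  let Iso : Subgroup ((surfaceGen (3 + 3 * m) → ℤ) ≃ₗ[ℤ] (surfaceGen (3 + 3 * m) → ℤ)) :=
    { carrier := {f | ∀ u u', symplForm (f u) (f u') = symplForm u u'}
      mul_mem' := fun {f g} hf hg u u' => by
        rw [Set.mem_setOf_eq] at hf hg
        rw [linearEquiv_mul_apply, linearEquiv_mul_apply, hf, hg]
      one_mem' := fun u u' => rfl
      inv_mem' := fun {f} hf u u' => by
        rw [Set.mem_setOf_eq] at hf
        rw [← hf (f⁻¹ u) (f⁻¹ u'), LinearEquiv.coe_inv, f.apply_symm_apply, f.apply_symm_apply] }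
  obtain ⟨f, hf, hfαβ⟩ := exists_mem_apply_eq_of_isSymplecticBasis Iso
    (fun i c u u' => symplForm_moveX i c u u') (fun i c u u' => symplForm_moveY i c u u')
    (fun i j h c u u' => symplForm_moveZ h c u u') (fun i j h c u u' => symplForm_moveW h c u u') hαβ
  refine ⟨α, β, f, hαβ, hfαβ, fun i x => ?_⟩
  have hfi : ∀ u u', symplForm (f u) (f u') = symplForm u u' := hf
  -- coordinates of `f⁻¹ x` are pairings of `x` with the basis
  have hcoord : ∀ (j : Fin (3 + 3 * m)), f.symm x (j, false) = symplForm x (β j) ∧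
      f.symm x (j, true) = -symplForm x (α j) := by
    intro j
    constructor
    · have := hfi (f.symm x) (Pi.single (j, true) 1)
      rw [f.apply_symm_apply, (hfαβ j).2, symplForm_single_true_right, mul_one] at this
      exact this.symm
    · have := hfi (f.symm x) (Pi.single (j, false) 1)
      rw [f.apply_symm_apply, (hfαβ j).1, symplForm_single_false_right, mul_one] at this
      rw [this, neg_neg]
  constructor
  · intro hx ⟨j, b⟩ hy
    rw [mem_s4CutSystem_iff] at hy
    cases b
    · -- `(j, a) ∉ Cᵢ`: `β_j ∈ L_i`
      simp only [Bool.false_eq_true, if_false, ne_eq, not_not] at hy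
      rw [(hcoord j).1]
      exact hiso i x hx _ (hy ▸ hβL j)
    · -- `(j, b) ∉ Cᵢ`: `α_j ∈ L_i`
      simp only [if_true] at hy
      rw [(hcoord j).2, hiso i x hx _ (hαL j i (Ne.symm hy)), neg_zero]
  · intro hx
    have hx' : x = f (f.symm x) := (f.apply_symm_apply x).symm
    rw [hx', ← Finset.univ_sum_single (f.symm x), map_sum]
    refine Submodule.sum_mem _ fun y _ => ?_
    by_cases hy : y ∈ s4CutSystem m i
    · have : (Pi.single y (f.symm x y) : surfaceGen (3 + 3 * m) → ℤ) =
          f.symm x y • (Pi.single y (1 : ℤ) : surfaceGen (3 + 3 * m) → ℤ) := by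
        ext z; simp [Pi.single_apply]
      rw [this, map_zsmul]
      refine Submodule.smul_mem _ _ ?_
      obtain ⟨j, b⟩ := y
      rw [mem_s4CutSystem_iff] at hy
      cases b
      · simp only [Bool.false_eq_true, if_false] at hy
        rw [(hfαβ j).1]
        exact hαL j i (Ne.symm hy)
      · simp only [if_true] at hy
        rw [(hfαβ j).2, ← hy]
        exact hβL j
    · rw [hx y hy, Pi.single_zero, map_zero]
      exact Submodule.zero_mem _

end AdaptedEquiv

section RealiseBasis

open Multiplicative

/-- **Realisation of the elementary symplectic group by automorphisms of the surface group**
(ZVC Thm. 3.6.7 (b) with 3.6.9, orientation-preserving part): for every symplectic basis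
`(α, β)` of `H₁(Σ_g; ℤ) = ℤ^{2g}` there are an automorphism `σ` of
`S_g = ⟨a₁, b₁, …, a_g, b_g ∣ ∏[aᵢ,bᵢ]⟩` and a `ℤ`-linear automorphism `F` of `H₁` with
`abelianize ∘ σ = F ∘ abelianize` and `F[aᵢ] = αᵢ`, `F[bᵢ] = βᵢ`.  Proof: the realisable
automorphisms of `H₁` form a subgroup containing all moves of types (A), (C) (above), hence
`moveW` (`moveW_one_eq`) and all integer parameters (`shear_mem`); now apply the transitivity
theorem `exists_mem_apply_eq_of_isSymplecticBasis`. [cite: ZieschangVogtColdewey1980, Thm. 3.6.7 (b)] -/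
theorem exists_mulEquiv_linearEquiv_of_isSymplecticBasis (g : ℕ)
    {α β : Fin g → surfaceGen g → ℤ} (hαβ : IsSymplecticBasis α β) :
    ∃ (σ : SurfaceGroup g ≃* SurfaceGroup g) (F : (surfaceGen g → ℤ) ≃ₗ[ℤ] (surfaceGen g → ℤ)),
      (∀ s, toAdd (SurfaceGroup.abelianize g (σ s)) = F (toAdd (SurfaceGroup.abelianize g s))) ∧
      ∀ i : Fin g, F (Pi.single (i, false) 1) = α i ∧ F (Pi.single (i, true) 1) = β i := by
  -- the subgroup of realisable automorphisms of `H₁`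
  let R : Subgroup ((surfaceGen g → ℤ) ≃ₗ[ℤ] (surfaceGen g → ℤ)) :=
    { carrier := {f | ∃ σ : SurfaceGroup g ≃* SurfaceGroup g, ∀ s,
        toAdd (SurfaceGroup.abelianize g (σ s)) = f (toAdd (SurfaceGroup.abelianize g s))}
      mul_mem' := fun {f f'} hf hf' => by
        obtain ⟨σ, hσ⟩ := hf
        obtain ⟨τ, hτ⟩ := hf'
        exact ⟨τ.trans σ, realises_mul hσ hτ⟩
      one_mem' := ⟨MulEquiv.refl _, fun s => rfl⟩
      inv_mem' := fun {f} hf => by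
        obtain ⟨σ, hσ⟩ := hf
        exact ⟨σ.symm, realises_inv hσ⟩ }
  have hX : ∀ i c, moveX i c ∈ R := fun i =>
    shear_mem _ _ R (exists_realises_moveX_one g i)
  have hY : ∀ i c, moveY i c ∈ R := fun i =>
    shear_mem _ _ R (exists_realises_moveY_one g i)
  have hZ : ∀ (i j : Fin g) (h : i ≠ j) (c : ℤ), moveZ i j h c ∈ R := fun i j h =>
    shear_mem _ _ R (exists_realises_moveZ_one g i j h)
  have hW : ∀ i j : Fin g, i ≠ j → ∀ c : ℤ, moveW i j c ∈ R := by
    intro i j h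
    refine shear_mem _ _ R ?_
    change moveW i j 1 ∈ R
    rw [moveW_one_eq h]
    exact R.mul_mem (R.mul_mem (R.mul_mem (R.mul_mem (hZ i j h 1) (hX j 1)) (hZ i j h (-1)))
      (hX i (-1))) (hX j (-1))
  obtain ⟨f, ⟨σ, hσ⟩, hf⟩ := exists_mem_apply_eq_of_isSymplecticBasis R hX hY hZ hW hαβ
  exact ⟨σ, f, hσ, hf⟩

/-- Corollary on the generators: `σ` carries `[aᵢ] ↦ αᵢ`, `[bᵢ] ↦ βᵢ` in `H₁`.
[cite: ZieschangVogtColdewey1980, Thm. 3.6.7 (b)] -/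
theorem exists_mulEquiv_abelianize_eq_of_isSymplecticBasis (g : ℕ)
    {α β : Fin g → surfaceGen g → ℤ} (hαβ : IsSymplecticBasis α β) :
    ∃ σ : SurfaceGroup g ≃* SurfaceGroup g, ∀ i : Fin g,
      toAdd (SurfaceGroup.abelianize g (σ (SurfaceGroup.a i))) = α i ∧
        toAdd (SurfaceGroup.abelianize g (σ (SurfaceGroup.b i))) = β i := by
  obtain ⟨σ, F, hσ, hF⟩ := exists_mulEquiv_linearEquiv_of_isSymplecticBasis g hαβ
  refine ⟨σ, fun i => ⟨?_, ?_⟩⟩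
  · rw [hσ, SurfaceGroup.a, SurfaceGroup.abelianize_of, toAdd_ofAdd]
    exact (hF i).1
  · rw [hσ, SurfaceGroup.b, SurfaceGroup.abelianize_of, toAdd_ofAdd]
    exact (hF i).2

end RealiseBasis

section Main

open Multiplicative Literature.Algebra.Lie
open Summit.SmoothPoincare4.SmoothPoincare4.Theses.CongruenceShadows

/-- **AbelianShadowStandard** (item `stmt-SmoothPoincare4-14599`, route CongruenceShadows, the
`c = 0` rung of `NilpotentShadowsStandard`): for every `(3+3m; m+1)` group trisection `K` of the
trivial group there is an automorphism `ψ` of the surface group `S = S_{3+3m}` carrying the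
abelian shadow `Nᵢ·[S,S]` of the standard trisection of `S⁴` (`N = s4Kernels.stabilizeIter m`)
onto `Kᵢ·[S,S]` for `i = 0, 1, 2` simultaneously.

Proof.  Identify `S/[S,S]` with `H = ℤ^{2g}` through `abelianize` (`ker = [S,S] = γ₂`,
`SurfaceGroupAbelianisationKernels`), so that `A·[S,S] ↦ span [A]` and the claim becomes: some
automorphism of `S` acts on `H` carrying the coordinate Lagrangians `Λᵢ = span{δ_x : x ∈ Cᵢ}`
(`stub_cutNormalForm`: `Nᵢ = ⟪Cᵢ⟫`) onto `Lᵢ = [Kᵢ]`.  By exactness of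
`Kᵢ → H → H₁(F_g) → 0` each `Lᵢ` is the kernel of a split surjection `H → ℤ^g` whose rows are
characters pulled back from the free group `S/Kᵢ`, hence `ν`-isotropic
(`SurfaceGroupFreeCharactersIsotropic`, the cup-product argument), so `Lᵢ` is Lagrangian
(`SymplecticLagrangianKernel`); the pairwise quotients give split surjections `H → ℤ^{m+1}`
killing two of the `L`'s, and the trivial triple quotient gives `L₀ + L₁ + L₂ = H`.  The
normal-form theorem `exists_adapted_linearEquiv` then produces a symplectic basis adapted to
`(L₀, L₁, L₂)` exactly as the coordinate basis is adapted to `(Λ₀, Λ₁, Λ₂)`, i.e. an isometry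
`f` of `H` with `f(Λᵢ) = Lᵢ`, and by the realisation theorem
(`exists_mulEquiv_linearEquiv_of_isSymplecticBasis`: `Aut S_g` realises every symplectic basis,
ZVC 3.6.7 (b)) `f` is induced by an automorphism `ψ` of `S`. [folklore] -/
theorem abelianShadowStandard_proof :
    Summit.SmoothPoincare4.SmoothPoincare4.Theses.CongruenceShadows.AbelianShadowStandard := by
  intro m K hK
  haveI : ∀ i, (K i).Normal := hK.normal
  set θ := SurfaceGroup.abelianize (3 + 3 * m) with hθ
  -- the three sublattices `Lᵢ = [Kᵢ] ≤ H₁`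
  set L : Fin 3 → Submodule ℤ (surfaceGen (3 + 3 * m) → ℤ) :=
    fun i => Submodule.span ℤ ((fun s => toAdd (θ s)) '' (K i : Set (SurfaceGroup (3 + 3 * m))))
    with hL
  -- single kernels: exponent sums of `S ↠ S/Kᵢ ≅ F_g`
  have hsingle : ∀ i : Fin 3, ∃ (R : (surfaceGen (3 + 3 * m) → ℤ) →ₗ[ℤ] (Fin (3 + 3 * m) → ℤ))
      (U : (Fin (3 + 3 * m) → ℤ) →ₗ[ℤ] (surfaceGen (3 + 3 * m) → ℤ))
      (φ : SurfaceGroup (3 + 3 * m) →* FreeGroup (Fin (3 + 3 * m))),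
      (∀ y, R (U y) = y) ∧
      (∀ s, R (toAdd (θ s)) =
        toAdd (FreeGroup.lift (fun k : Fin (3 + 3 * m) => ofAdd (Pi.single k (1 : ℤ))) (φ s))) ∧
      LinearMap.ker R = L i := by
    intro i
    obtain ⟨R, U, φ, hRU, hRθ, -, -, hker⟩ := SurfaceGroup.exists_linearMap_section_of_isFreeOfRank
      (normalClosure (K i : Set (SurfaceGroup (3 + 3 * m)))) (hK.free_quotient i)
    refine ⟨R, U, φ, hRU, hRθ, ?_⟩
    rw [hker, hL]
    exact SurfaceGroup.span_image_normalClosure _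
  -- the rank condition `ℤ^g × ℤ^g ≅ ℤ^{2g}`
  have e : ((Fin (3 + 3 * m) → ℤ) × (Fin (3 + 3 * m) → ℤ)) ≃ₗ[ℤ] (surfaceGen (3 + 3 * m) → ℤ) :=
    (LinearEquiv.sumArrowLequivProdArrow (Fin (3 + 3 * m)) (Fin (3 + 3 * m)) ℤ ℤ).symm ≪≫ₗ
      LinearEquiv.funCongrLeft ℤ ℤ ((Equiv.prodComm _ _).trans (Equiv.boolProdEquivSum _))
  -- each `Lᵢ` is Lagrangian
  have hlag : ∀ i, (∀ x ∈ L i, ∀ y ∈ L i, symplForm x y = 0) ∧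
      ∀ x, (∀ y ∈ L i, symplForm x y = 0) → x ∈ L i := by
    intro i
    obtain ⟨R, U, φ, hRU, hRθ, hker⟩ := hsingle i
    rw [← hker]
    refine symplForm_ker_of_section R U hRU e fun c d => ?_
    -- the rows are characters pulled back from the free group `S/Kᵢ`
    set E : FreeGroup (Fin (3 + 3 * m)) →* Multiplicative (Fin (3 + 3 * m) → ℤ) :=
      FreeGroup.lift (fun k : Fin (3 + 3 * m) => ofAdd (Pi.single k (1 : ℤ))) with hE
    have hrow : ∀ c, (fun x : surfaceGen (3 + 3 * m) => R (Pi.single x 1) c) = fun x =>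
        toAdd (((AddMonoidHom.toMultiplicative (Pi.evalAddMonoidHom (fun _ : Fin (3 + 3 * m) => ℤ) c)).comp
          E) (φ (PresentedGroup.of x))) := by
      intro c
      funext x
      have := hRθ (PresentedGroup.of x)
      rw [hθ, SurfaceGroup.abelianize_of, toAdd_ofAdd] at this
      rw [this]
      rfl
    rw [hrow c, hrow d]
    exact symplForm_comp_freeGroupHom_eq_zero φ _ _
  -- pair kernels: exponent sums of `S ↠ S/KᵢKⱼ ≅ F_{m+1}`
  have hpair : ∀ l : Fin 3, ∃ (Rp : (surfaceGen (3 + 3 * m) → ℤ) →ₗ[ℤ] (Fin (m + 1) → ℤ))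
      (Up : (Fin (m + 1) → ℤ) →ₗ[ℤ] (surfaceGen (3 + 3 * m) → ℤ)),
      (∀ y, Rp (Up y) = y) ∧ ∀ l', l ≠ l' → ∀ x ∈ L l', Rp x = 0 := by
    have aux : ∀ i j : Fin 3, i ≠ j → ∃ (Rp : (surfaceGen (3 + 3 * m) → ℤ) →ₗ[ℤ] (Fin (m + 1) → ℤ))
        (Up : (Fin (m + 1) → ℤ) →ₗ[ℤ] (surfaceGen (3 + 3 * m) → ℤ)),
        (∀ y, Rp (Up y) = y) ∧ (∀ x ∈ L i, Rp x = 0) ∧ ∀ x ∈ L j, Rp x = 0 := by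
      intro i j hij
      obtain ⟨R, U, φ, hRU, -, -, -, hker⟩ :=
        SurfaceGroup.exists_linearMap_section_of_isFreeOfRank
          (normalClosure ((K i : Set (SurfaceGroup (3 + 3 * m))) ∪ K j)) (hK.free_pairQuotient i j hij)
      have hle : L i ⊔ L j ≤ LinearMap.ker R := by
        rw [hker, SurfaceGroup.span_image_normalClosure, Set.image_union, Submodule.span_union]
      exact ⟨R, U, hRU, fun x hx => hle (Submodule.mem_sup_left hx),
        fun x hx => hle (Submodule.mem_sup_right hx)⟩
    intro l
    fin_cases l
    · obtain ⟨Rp, Up, h1, h2, h3⟩ := aux 1 2 (by decide)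
      refine ⟨Rp, Up, h1, fun l' hl' => ?_⟩
      fin_cases l'
      · exact absurd rfl hl'
      · exact h2
      · exact h3
    · obtain ⟨Rp, Up, h1, h2, h3⟩ := aux 0 2 (by decide)
      refine ⟨Rp, Up, h1, fun l' hl' => ?_⟩
      fin_cases l'
      · exact h2
      · exact absurd rfl hl'
      · exact h3
    · obtain ⟨Rp, Up, h1, h2, h3⟩ := aux 0 1 (by decide)
      refine ⟨Rp, Up, h1, fun l' hl' => ?_⟩
      fin_cases l'
      · exact h2
      · exact h3
      · exact absurd rfl hl'
  choose Rp Up hRU hkerp using hpair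
  -- the total: `L₀ + L₁ + L₂ = H` from the trivial triple quotient
  have htop : ∀ x : surfaceGen (3 + 3 * m) → ℤ, ∃ y : Fin 3 → surfaceGen (3 + 3 * m) → ℤ,
      (∀ l, y l ∈ L l) ∧ x = ∑ l, y l := by
    obtain ⟨et⟩ := hK.triple
    haveI : Subsingleton K.tripleQuotient := et.toEquiv.subsingleton
    have hnc : normalClosure (⋃ i, (K i : Set (SurfaceGroup (3 + 3 * m)))) = ⊤ := by
      rw [eq_top_iff]
      intro s _
      have : (QuotientGroup.mk s : K.tripleQuotient) = 1 := Subsingleton.elim _ _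
      exact (QuotientGroup.eq_one_iff s).1 this
    have hsup : K 0 ⊔ K 1 ⊔ K 2 = ⊤ := by
      rw [eq_top_iff, ← hnc]
      refine normalClosure_le_normal (Set.iUnion_subset fun i => ?_)
      fin_cases i
      · exact fun x hx => Subgroup.mem_sup_left (Subgroup.mem_sup_left hx)
      · exact fun x hx => Subgroup.mem_sup_left (Subgroup.mem_sup_right hx)
      · exact fun x hx => Subgroup.mem_sup_right hx
    have hLsup : L 0 ⊔ L 1 ⊔ L 2 = ⊤ := by
      simp only [hL]
      rw [← SurfaceGroup.span_image_sup, ← SurfaceGroup.span_image_sup, hsup,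
        SurfaceGroup.span_image_top]
    intro x
    have hx : x ∈ L 0 ⊔ L 1 ⊔ L 2 := by rw [hLsup]; exact Submodule.mem_top
    obtain ⟨y01, hy01, y2, hy2, rfl⟩ := Submodule.mem_sup.1 hx
    obtain ⟨y0, hy0, y1, hy1, rfl⟩ := Submodule.mem_sup.1 hy01
    refine ⟨![y0, y1, y2], fun l => ?_, ?_⟩
    · fin_cases l
      · exact hy0
      · exact hy1
      · exact hy2
    · rw [Fin.sum_univ_three]
      rfl
  -- the adapted basis, its linear automorphism, and a realising automorphism of `S`
  obtain ⟨α, β, f, hαβ, hfαβ, hLf⟩ := exists_adapted_linearEquiv m L (fun l => (hlag l).1)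
    (fun l => (hlag l).2) Rp Up hRU hkerp htop
  obtain ⟨σ, F, hσF, hF⟩ := exists_mulEquiv_linearEquiv_of_isSymplecticBasis (3 + 3 * m) hαβ
  have hFf : F = f := by
    refine LinearEquiv.toLinearMap_injective (LinearMap.pi_ext fun y n => ?_)
    have hyn : (Pi.single y n : surfaceGen (3 + 3 * m) → ℤ) = n • Pi.single y (1 : ℤ) := by
      ext z
      simp [Pi.single_apply]
    obtain ⟨j, b⟩ := y
    rw [LinearEquiv.coe_coe, LinearEquiv.coe_coe, hyn, map_zsmul, map_zsmul]
    cases b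
    · rw [(hF j).1, (hfαβ j).1]
    · rw [(hF j).2, (hfαβ j).2]
  subst hFf
  refine ⟨σ, fun i => ?_⟩
  rw [← SurfaceGroup.ker_abelianize_eq_lowerCentralSeries]
  ext s
  rw [Subgroup.mem_map_equiv, SurfaceGroup.mem_sup_ker_abelianize_iff,
    SurfaceGroup.mem_sup_ker_abelianize_iff]
  have hσs : toAdd (θ (σ.symm s)) = F.symm (toAdd (θ s)) := by
    have := hσF (σ.symm s)
    rw [σ.apply_symm_apply] at this
    rw [hθ, this, F.symm_apply_apply]
  rw [← hθ, hσs, hθ, span_image_stabilizeIter m i, mem_span_single_image_iff]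
  exact (hLf i _).symm

end Main


end Summit.SmoothPoincare4.SmoothPoincare4.Theorems.AbelianShadowStandard

end
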